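import Summits.AtomisticToContinuum.HydrodynamicLimit.Theorems.OneFlightGossipEngineEquilibriumClampedCollisionalWindowLDRadialVirialDefs
import Summits.AtomisticToContinuum.HydrodynamicLimit.Theorems.OneFlightGossipEngineEquilibriumClampedCollisionalWindowLDStubCollisionDecomposition

/-!
# Pathwise caps of the clamped radial virials (line `radial-virial-polarization`, crux `EquilibriumClampedCollisionalWindowLD`,
stmt-AtomisticToContinuum-13733)

The transfer-activity clamp bounds every clamped radial virial PATHWISE on good orbits: for a record weight with `|Γ| ≤ M`,
`|w⁻¹ ε_N R_Γ| ≤ ½ M V (N+1)` (`abs_virN_le`) — each unclamped particle carries transfer impulse `≤ Vτ/σ`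
(`CollisionDecomposition.sum_flagG_mul_impulse_le`, p110978; `‖Δv_fst‖ ≤ impulse` is `CollisionDecomposition.norm_sub_le_impulse`,
p108024) and `w⁻¹ ε_N τ/σ = 1`. Consequences recorded for the four LD stubs of
the line: the exponential moments in `IsotropicUpperTail/LowerTail`, `TracelessVirialLD`, `ThermalTransferLD` are finite at every
`N` on the collision side (so their whole content is the RATE `∀ε`), and the Newton-cradle relay that refutes the FILED decl is
switched off (its relay spheres have unbounded transfer activity). This is the `HighMomentumCutoff` evasion of the line, typed.

prover-line-stmt-AtomisticToContinuum-13733-c2-0, 2026-08-16.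
-/

noncomputable section

open MeasureTheory Set Filter
open scoped ENNReal BigOperators
open Literature.Analysis.FluidPDE Literature.MathematicalPhysics.KineticTheory
open Literature.Analysis.FunctionSpaces (Torus.partialDeriv Torus.IsSmooth)

namespace Summit.AtomisticToContinuum.HydrodynamicLimit.Theorems.ClampedTransferCoin

namespace RadialVirial

variable {σ τ V : ℝ} {N : ℕ}

/-- `flagG ∈ [0, 1]`. -/
theorem flagG_nonneg_le_one (Φ : Flow σ N) (i : Fin (N + 1)) (z : Phase N) :
    0 ≤ flagG σ τ V Φ i z ∧ flagG σ τ V Φ i z ≤ 1 := by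
  unfold flagG; split_ifs <;> norm_num

/-- **Pathwise cap of the clamped radial virial** (registered anchor of this file): on a good orbit, for a record weight bounded
by `M`, `|w⁻¹ ε_N R_Γ| ≤ ½ M V (N+1)`. -/
theorem abs_virN_le (hσ : 0 < σ) (hτ : 0 < τ) (hV : 0 ≤ V) (Φ : Flow σ N) {z : Phase N} (hz : z ∈ Φ.good) {Γ : Rec N → ℝ} {M : ℝ} (hM0 : 0 ≤ M) (hM : ∀ c, |Γ c| ≤ M) : |virN σ τ V Φ Γ z| ≤ M / 2 * V * ((N : ℝ) + 1) := by
  have hfin : (collisionTimes (Torus.geometry (Fin 3)) (hsDiameter σ N) (fun s => Φ.flow s z) ∩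
      Set.Ioc 0 (window τ N)).Finite :=
    Φ.finite_collisionTimes_inter hz Set.Ioc_subset_Icc_self
  have hbudget := CollisionDecomposition.sum_flagG_mul_impulse_le (N := N) hσ hτ hV Φ hfin
  have hw := window_pos hτ N
  have hε : 0 < hsDiameter σ N := by unfold hsDiameter; positivity
  -- bound on the finite-sum form of `Rvir`
  have hR : |Rvir σ τ V Φ Γ z| ≤ M / 2 * (((N : ℝ) + 1) * (τ / σ * V)) := by
    unfold Rvir
    rw [HardSphereFlow.collisionSum_eq, collisionSum_eq_finset_sum hfin]
    refine (Finset.abs_sum_le_sum_abs _ _).trans ?_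
    have step : ∀ t ∈ hfin.toFinset,
        |∑ p ∈ contactPairs (Torus.geometry (Fin 3)) (hsDiameter σ N) (Φ.flow t z),
          (fun c : Rec N => flagG σ τ V Φ c.fst z * flagG σ τ V Φ c.snd z * (Γ c * ‖c.postVel.1 - c.preVel.1‖) / 2)
            (HardSphereCollisionRecord.ofConfig (Torus.geometry (Fin 3)) (hsDiameter σ N) (Φ.flow t z) t p.1 p.2)| ≤
        ∑ p ∈ contactPairs (Torus.geometry (Fin 3)) (hsDiameter σ N) (Φ.flow t z),
          M / 2 * (flagG σ τ V Φ p.1 z *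
            impulse (HardSphereCollisionRecord.ofConfig (Torus.geometry (Fin 3)) (hsDiameter σ N) (Φ.flow t z) t p.1 p.2)) := by
      intro t _
      refine (Finset.abs_sum_le_sum_abs _ _).trans (Finset.sum_le_sum fun p _ => ?_)
      simp only [HardSphereCollisionRecord.ofConfig_fst, HardSphereCollisionRecord.ofConfig_snd]
      set c := HardSphereCollisionRecord.ofConfig (Torus.geometry (Fin 3)) (hsDiameter σ N) (Φ.flow t z) t p.1 p.2
      have hf1 := flagG_nonneg_le_one (τ := τ) (V := V) Φ p.1 z
      have hf2 := flagG_nonneg_le_one (τ := τ) (V := V) Φ p.2 z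
      have h1 : |Γ c| * ‖c.postVel.1 - c.preVel.1‖ ≤ M * impulse c :=
        mul_le_mul (hM c) (CollisionDecomposition.norm_sub_le_impulse c) (norm_nonneg _) hM0
      have h3 : 0 ≤ |Γ c| * ‖c.postVel.1 - c.preVel.1‖ := by positivity
      have habs : |flagG σ τ V Φ p.1 z * flagG σ τ V Φ p.2 z * (Γ c * ‖c.postVel.1 - c.preVel.1‖) / 2| =
          flagG σ τ V Φ p.1 z * flagG σ τ V Φ p.2 z * (|Γ c| * ‖c.postVel.1 - c.preVel.1‖) / 2 := by
        rw [abs_div, abs_mul, abs_mul, abs_mul, abs_of_nonneg hf1.1, abs_of_nonneg hf2.1, abs_norm,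
          abs_of_pos (by norm_num : (0 : ℝ) < 2)]
      rw [habs]
      have hA : flagG σ τ V Φ p.1 z * flagG σ τ V Φ p.2 z * (|Γ c| * ‖c.postVel.1 - c.preVel.1‖) ≤
          flagG σ τ V Φ p.1 z * (|Γ c| * ‖c.postVel.1 - c.preVel.1‖) := by
        have h := mul_le_mul_of_nonneg_left hf2.2 (mul_nonneg hf1.1 h3)
        calc flagG σ τ V Φ p.1 z * flagG σ τ V Φ p.2 z * (|Γ c| * ‖c.postVel.1 - c.preVel.1‖)
            = flagG σ τ V Φ p.1 z * (|Γ c| * ‖c.postVel.1 - c.preVel.1‖) * flagG σ τ V Φ p.2 z := by ring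
          _ ≤ flagG σ τ V Φ p.1 z * (|Γ c| * ‖c.postVel.1 - c.preVel.1‖) * 1 := h
          _ = flagG σ τ V Φ p.1 z * (|Γ c| * ‖c.postVel.1 - c.preVel.1‖) := by ring
      have hB : flagG σ τ V Φ p.1 z * (|Γ c| * ‖c.postVel.1 - c.preVel.1‖) ≤ flagG σ τ V Φ p.1 z * (M * impulse c) :=
        mul_le_mul_of_nonneg_left h1 hf1.1
      calc flagG σ τ V Φ p.1 z * flagG σ τ V Φ p.2 z * (|Γ c| * ‖c.postVel.1 - c.preVel.1‖) / 2
          ≤ flagG σ τ V Φ p.1 z * (M * impulse c) / 2 := by linarith [hA.trans hB]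
        _ = M / 2 * (flagG σ τ V Φ p.1 z * impulse c) := by ring
    refine (Finset.sum_le_sum step).trans ?_
    have e : (∑ t ∈ hfin.toFinset, ∑ p ∈ contactPairs (Torus.geometry (Fin 3)) (hsDiameter σ N) (Φ.flow t z),
          M / 2 * (flagG σ τ V Φ p.1 z *
            impulse (HardSphereCollisionRecord.ofConfig (Torus.geometry (Fin 3)) (hsDiameter σ N) (Φ.flow t z) t p.1 p.2))) =
        M / 2 * ∑ t ∈ hfin.toFinset, ∑ p ∈ contactPairs (Torus.geometry (Fin 3)) (hsDiameter σ N) (Φ.flow t z),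
          flagG σ τ V Φ p.1 z *
            impulse (HardSphereCollisionRecord.ofConfig (Torus.geometry (Fin 3)) (hsDiameter σ N) (Φ.flow t z) t p.1 p.2) := by
      rw [Finset.mul_sum]
      refine Finset.sum_congr rfl fun t _ => ?_
      rw [Finset.mul_sum]
    rw [e]
    exact mul_le_mul_of_nonneg_left hbudget (by positivity)
  -- normalisation `w⁻¹ ε (τ/σ) = 1`
  have hnorm : (window τ N)⁻¹ * (hsDiameter σ N * (((N : ℝ) + 1) * (τ / σ * V))) = V * ((N : ℝ) + 1) := by
    have e := hsDiameter_mul_div σ τ hσ.ne' N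
    calc (window τ N)⁻¹ * (hsDiameter σ N * (((N : ℝ) + 1) * (τ / σ * V)))
        = (window τ N)⁻¹ * (hsDiameter σ N * (τ / σ)) * (((N : ℝ) + 1) * V) := by ring
      _ = (window τ N)⁻¹ * window τ N * (((N : ℝ) + 1) * V) := by rw [e]
      _ = V * ((N : ℝ) + 1) := by rw [inv_mul_cancel₀ hw.ne']; ring
  unfold virN
  rw [abs_mul, abs_mul, abs_of_pos (inv_pos.2 hw), abs_of_pos hε]
  calc (window τ N)⁻¹ * (hsDiameter σ N * |Rvir σ τ V Φ Γ z|)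
      ≤ (window τ N)⁻¹ * (hsDiameter σ N * (M / 2 * (((N : ℝ) + 1) * (τ / σ * V)))) := by gcongr
    _ = M / 2 * ((window τ N)⁻¹ * (hsDiameter σ N * (((N : ℝ) + 1) * (τ / σ * V)))) := by ring
    _ = M / 2 * V * ((N : ℝ) + 1) := by rw [hnorm]; ring

/-- The isotropic collision term is capped by the weight: `|w⁻¹ ε_N R_{ψ∘fstPos}| ≤ ½ ‖ψ‖_∞ V (N+1)`. -/
theorem abs_virN_weight_le (hσ : 0 < σ) (hτ : 0 < τ) (hV : 0 ≤ V) (Φ : Flow σ N) {z : Phase N} (hz : z ∈ Φ.good)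
    {ψ : T3 → ℝ} {M : ℝ} (hM0 : 0 ≤ M) (hM : ∀ x, |ψ x| ≤ M) :
    |virN σ τ V Φ (fun c => ψ c.fstPos) z| ≤ M / 2 * V * ((N : ℝ) + 1) :=
  abs_virN_le hσ hτ hV Φ hz hM0 fun c => hM c.fstPos

end RadialVirial

end Summit.AtomisticToContinuum.HydrodynamicLimit.Theorems.ClampedTransferCoin

end
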